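import Literature.Geometry.Lorentzian.KerrDeSitter
import Literature.Geometry.Lorentzian.KerrSchildCoord
import Literature.Geometry.Lorentzian.ChartCalculus
import HarnessLib

/-!
# The Kerr–de Sitter star-chart components are real-analytic (discharge of `KerrDeSitter.contMDiff_bilin` and `KerrDeSitter.contMDiff_timeVector`)

Sibling proof file of `KerrDeSitter.lean` (D-0014: a named fact `def X : Prop` is discharged as
`theorem X_holds : X`), in the style of `KerrSchildCoord.lean` (which discharges the `Λ = 0` twins
`Kerr.contMDiff_bilin`, `Kerr.contMDiff_timeVector`).  It discharges two of the four fields of the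
`Prop`-class `KerrDeSitter.Facts`:

* `KerrDeSitter.contMDiff_bilin_holds : ∀ M a Λ r₀, KerrDeSitter.contMDiff_bilin M a Λ r₀` — for
  regular parameters the section `x ↦ g_{M,a,Λ}(x)` of the bundle of bilinear forms on
  `T(Kerr.region a r₀)` is real-analytic (Hintz–Vasy 2018, Prop. 3.5: `g_b` is smooth on `M°`,
  including the axis; Petersen–Vasy arXiv:2112.01355, §1.1: the Kerr–de Sitter family is
  real-analytic in the star coordinates);
* `KerrDeSitter.contMDiff_timeVector_holds : ∀ M a Λ r₀, KerrDeSitter.contMDiff_timeVector M a Λ r₀`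
  — the vector field `x ↦ T(x) = −g♯(dt*)` is a real-analytic section of `T(Kerr.region a r₀)`
  (Hintz–Vasy 2018, Prop. 3.5: smooth dependence of the dual metric `G_b`).

The other two fields (`isLorentzian_bilin`, `bilin_timeVector`) are already theorems of the tree
(`KerrDeSitterLorentzian.lean`, `KerrDeSitterData.lean`).

## The proof

Exactly the road of `KerrSchildCoord.lean`.  By `OpensChart.contMDiffAt_bilinSection_iff` /
`OpensChart.contMDiffAt_section_iff` + `OpensChart.contMDiffAt_iff` (`ChartCalculus.lean`) the two
manifold statements on the open set `Kerr.region a r₀ ⊆ E4` are ordinary `ContDiffAt ℝ ω` statements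
about the explicit component functions `KerrDeSitter.bilin M a Λ : E4 → (E4 →L E4 →L ℝ)` and
`KerrDeSitter.timeVector M a Λ : E4 → E4` at points with `r > max r₀ 0`.  Every ingredient of these
formulas is a rational function of the coordinates `x`, of the Kerr–Schild radius `r = Kerr.radius a x`
(real-analytic on `{r > 0}`, ★ `Kerr.contDiffAt_radius`) and of `√R`, `R = tiltNormSq M a Λ r`, whose
denominators do not vanish under `IsRegular M a Λ r₀` at such points: `Λ ≥ 0` gives `Ξ > 0`,
`Δ_θ > 0`, `1 + p > 0`; `r > 0` gives `ρ² > 0`, `r² + a² > 0`; and `R > 0` there is part of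
`IsRegular`.  Contents: `C^n` lemmas (every `n ≤ ω`) for the radial functions `delta`,
`cosmoPotential`, `massPotential`, `auxC`, `tiltNormSq`, `tilt`, `radialCoeff` on `{r > 0}` resp.
`{R > 0}`, for the point functions `rhoSq`, `sinSq`, `deltaTheta`, `sigmaCoeff`, for the covector
fields `E4.sigma`, `drCovector`, `omegaCovector`, for `angularBilin`, `bilin` and `timeVector`, then
the two discharges.  THEOREMS ONLY (no definition, no named fact, no `sorry`, no instance); net debt −2.

## References

* P. Hintz, A. Vasy, *The global non-linear stability of the Kerr–de Sitter family of black holes*,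
  Acta Math. 220 (2018), §3.2, (3.13)–(3.15) and Prop. 3.5 (smoothness of `g_b` and of the dual
  metric `G_b` on `M°`).  [HintzVasy2018]
* O. Petersen, A. Vasy, *Wave equations in the Kerr–de Sitter spacetime: the full subextremal
  range*, arXiv:2112.01355, §1.1, (1.4)–(1.8) (the star coordinates; real-analyticity).
  [PetersenVasy2021]
* M. Visser, *The Kerr spacetime: a brief introduction*, arXiv:0706.0622, (33)–(35) (the
  Kerr–Schild radius and its regularity off the disc).  [arXiv07060622]
-/

noncomputable section

open Set Filter Bundle
open scoped ContDiff Topology Manifold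

namespace Literature.Geometry.Lorentzian.KerrDeSitter

variable {n : WithTop ℕ∞}

/-! ### The radial functions are `C^n` on `{r > 0}` (resp. `{R > 0}`) -/

/-- `Ξ > 0` and hence `Ξ ≠ 0` for `Λ ≥ 0` (Carter 1968). [cite: Carter1968] -/
theorem xi_ne_zero {Λ : ℝ} (hΛ : 0 ≤ Λ) (a : ℝ) : xi a Λ ≠ 0 := (xi_pos hΛ a).ne'

/-- The de Sitter potential `p = (Λ/3)(r² + a²)/Ξ` is nonnegative for `Λ ≥ 0`
(Gibbons–Lü–Page–Pope 2005, §2). [cite: GibbonsEtAl2004, §2] -/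
theorem cosmoPotential_nonneg {Λ : ℝ} (hΛ : 0 ≤ Λ) (a r : ℝ) : 0 ≤ cosmoPotential a Λ r := by
  unfold cosmoPotential
  exact div_nonneg (by positivity) (xi_pos hΛ a).le

/-- `Δ_r` is a polynomial in `r`, hence `C^n` (Petersen–Vasy arXiv:2112.01355, (1.1)). [cite: PetersenVasy2021, (1.1)] -/
theorem contDiff_delta (M a Λ : ℝ) : ContDiff ℝ n (delta M a Λ) := by
  unfold delta
  exact (((contDiff_id.pow 2).add contDiff_const).mul
    (contDiff_const.sub (contDiff_const.mul (contDiff_id.pow 2)))).sub (contDiff_const.mul contDiff_id)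

/-- The de Sitter potential is a polynomial in `r` divided by the constant `Ξ`, hence `C^n`
(Gibbons–Lü–Page–Pope 2005, §2). [cite: GibbonsEtAl2004, §2] -/
theorem contDiff_cosmoPotential (a Λ : ℝ) : ContDiff ℝ n (cosmoPotential a Λ) := by
  unfold cosmoPotential
  exact (contDiff_const.mul ((contDiff_id.pow 2).add contDiff_const)).div_const _

/-- The mass potential `n = 2Mr/(Ξ(r² + a²))` is `C^n` at every `r > 0` when `Λ ≥ 0` (the
denominator is positive). Gibbons–Lü–Page–Pope 2005, §2. [cite: GibbonsEtAl2004, §2] -/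
theorem contDiffAt_massPotential (M a : ℝ) {Λ : ℝ} (hΛ : 0 ≤ Λ) {r : ℝ} (hr : 0 < r) :
    ContDiffAt ℝ n (massPotential M a Λ) r := by
  unfold massPotential
  refine (contDiffAt_const.mul contDiffAt_id).div
    (contDiffAt_const.mul ((contDiffAt_id.pow 2).add contDiffAt_const)) ?_
  have := xi_pos hΛ a
  positivity

/-- The auxiliary function `C = p + n + 1/(1 + p)` is `C^n` at every `r > 0` when `Λ ≥ 0`
(`1 + p ≥ 1`). [cite: PetersenVasy2021, (1.8)] -/
theorem contDiffAt_auxC (M a : ℝ) {Λ : ℝ} (hΛ : 0 ≤ Λ) {r : ℝ} (hr : 0 < r) :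
    ContDiffAt ℝ n (auxC M a Λ) r := by
  unfold auxC
  have hp := (contDiff_cosmoPotential a Λ (n := n)).contDiffAt (x := r)
  refine (hp.add (contDiffAt_massPotential M a hΛ hr)).add
    (contDiffAt_const.div (contDiffAt_const.add hp) ?_)
  have := cosmoPotential_nonneg hΛ a r
  positivity

/-- The radicand `R = (p − n)² + (1 − p − n)C` is `C^n` at every `r > 0` when `Λ ≥ 0`.
[cite: PetersenVasy2021, (1.8)] -/
theorem contDiffAt_tiltNormSq (M a : ℝ) {Λ : ℝ} (hΛ : 0 ≤ Λ) {r : ℝ} (hr : 0 < r) :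
    ContDiffAt ℝ n (tiltNormSq M a Λ) r := by
  unfold tiltNormSq
  have hp := (contDiff_cosmoPotential a Λ (n := n)).contDiffAt (x := r)
  have hm := contDiffAt_massPotential M a hΛ hr (n := n)
  exact ((hp.sub hm).pow 2).add (((contDiffAt_const.sub hp).sub hm).mul (contDiffAt_auxC M a hΛ hr))

/-- The tilt `f = (p − n)/√R` is `C^n` at every `r > 0` with `R(r) > 0` when `Λ ≥ 0` (the square
root has a positive argument). Petersen–Vasy arXiv:2112.01355, (1.6)–(1.7) («many analytic
choices» of `f`; ours is algebraic in `r` and `√R`). [cite: PetersenVasy2021, (1.6)–(1.7)] -/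
theorem contDiffAt_tilt (M a : ℝ) {Λ : ℝ} (hΛ : 0 ≤ Λ) {r : ℝ} (hr : 0 < r)
    (hR : 0 < tiltNormSq M a Λ r) : ContDiffAt ℝ n (tilt M a Λ) r := by
  unfold tilt
  have hp := (contDiff_cosmoPotential a Λ (n := n)).contDiffAt (x := r)
  have hm := contDiffAt_massPotential M a hΛ hr (n := n)
  exact (hp.sub hm).div ((contDiffAt_tiltNormSq M a hΛ hr).sqrt hR.ne') (Real.sqrt_pos.2 hR).ne'

/-- The radial coefficient `q̂ = C/(Ξ(r² + a²)R)` is `C^n` at every `r > 0` with `R(r) > 0` when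
`Λ ≥ 0` (the manifestly regular form of `(1 − f²)/Δ_r`, Petersen–Vasy (1.8)). [cite: PetersenVasy2021, (1.8)] -/
theorem contDiffAt_radialCoeff (M a : ℝ) {Λ : ℝ} (hΛ : 0 ≤ Λ) {r : ℝ} (hr : 0 < r)
    (hR : 0 < tiltNormSq M a Λ r) : ContDiffAt ℝ n (radialCoeff M a Λ) r := by
  unfold radialCoeff
  refine (contDiffAt_auxC M a hΛ hr).div
    ((contDiffAt_const.mul ((contDiffAt_id.pow 2).add contDiffAt_const)).mul
      (contDiffAt_tiltNormSq M a hΛ hr)) ?_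
  have := xi_pos hΛ a
  positivity

/-! ### The point functions of the Cartesian chart are `C^n` on `{r > 0}` -/

section Point

variable {a : ℝ} {x : E4}

/-- `ρ² = r² + a²z²/r²` is `C^n` wherever `r > 0` (Visser arXiv:0706.0622, (33), with the
analytic radius ★ `Kerr.contDiffAt_radius`). [cite: arXiv07060622, (33)] -/
theorem contDiffAt_rhoSq (a : ℝ) {x : E4} (hx : 0 < Kerr.radius a x) :
    ContDiffAt ℝ n (rhoSq a) x := by
  unfold rhoSq
  have hr := Kerr.contDiffAt_radius hx (n := n)
  have h3 := (Kerr.contDiff_coord 3 (n := n)).contDiffAt (x := x)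
  exact (hr.pow 2).add ((contDiffAt_const.mul (h3.pow 2)).div (hr.pow 2) (pow_ne_zero 2 hx.ne'))

/-- `sin²θ = 1 − z²/r²` is `C^n` wherever `r > 0` (Visser arXiv:0706.0622, §5). [cite: arXiv07060622, §5] -/
theorem contDiffAt_sinSq (a : ℝ) {x : E4} (hx : 0 < Kerr.radius a x) :
    ContDiffAt ℝ n (sinSq a) x := by
  unfold sinSq
  have hr := Kerr.contDiffAt_radius hx (n := n)
  have h3 := (Kerr.contDiff_coord 3 (n := n)).contDiffAt (x := x)
  exact contDiffAt_const.sub ((h3.pow 2).div (hr.pow 2) (pow_ne_zero 2 hx.ne'))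

/-- `Δ_θ = 1 + Λa²z²/(3r²)` is `C^n` wherever `r > 0` (Petersen–Vasy (1.5), in the Cartesian
chart `cos θ = z/r`). [cite: PetersenVasy2021, (1.5)] -/
theorem contDiffAt_deltaTheta (a Λ : ℝ) {x : E4} (hx : 0 < Kerr.radius a x) :
    ContDiffAt ℝ n (deltaTheta a Λ) x := by
  unfold deltaTheta
  have hr := Kerr.contDiffAt_radius hx (n := n)
  have h3 := (Kerr.contDiff_coord 3 (n := n)).contDiffAt (x := x)
  exact contDiffAt_const.add ((contDiffAt_const.mul (h3.pow 2)).div (hr.pow 2) (pow_ne_zero 2 hx.ne'))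

/-- The coefficient `c_σ` of `σ ⊗ σ` is `C^n` wherever `r > 0`, for `Λ ≥ 0` (its denominators
`Δ_θ (r²+a²)²` and `Ξ² ρ² Δ_θ (r²+a²)²` are positive). Hintz–Vasy 2018, proof of (3.15). [cite: HintzVasy2018, §3.2 (3.15)] -/
theorem contDiffAt_sigmaCoeff (a : ℝ) {Λ : ℝ} (hΛ : 0 ≤ Λ) {x : E4} (hx : 0 < Kerr.radius a x) :
    ContDiffAt ℝ n (sigmaCoeff a Λ) x := by
  unfold sigmaCoeff
  have hr := Kerr.contDiffAt_radius hx (n := n)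
  have hΔ := contDiffAt_deltaTheta a Λ hx (n := n)
  have hρ := contDiffAt_rhoSq a hx (n := n)
  have hra : ContDiffAt ℝ n (fun y ↦ Kerr.radius a y ^ 2 + a ^ 2) x := (hr.pow 2).add contDiffAt_const
  have hΔ0 := deltaTheta_pos a hΛ x
  have hρ0 := rhoSq_pos a hx
  have hξ0 := xi_pos hΛ a
  have hT₁ : ContDiffAt ℝ n
      (fun y ↦ a ^ 2 / (deltaTheta a Λ y * (Kerr.radius a y ^ 2 + a ^ 2) ^ 2)) x :=
    contDiffAt_const.div (hΔ.mul (hra.pow 2)) (by positivity)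
  have hT₂ : ContDiffAt ℝ n
      (fun y ↦ a ^ 2 * (1 - Λ / 3 * Kerr.radius a y ^ 2) *
          (deltaTheta a Λ y * (Kerr.radius a y ^ 2 + a ^ 2) + xi a Λ * rhoSq a y) /
        (xi a Λ ^ 2 * rhoSq a y * deltaTheta a Λ y * (Kerr.radius a y ^ 2 + a ^ 2) ^ 2)) x :=
    ((contDiffAt_const.mul (contDiffAt_const.sub (contDiffAt_const.mul (hr.pow 2)))).mul
      ((hΔ.mul hra).add (contDiffAt_const.mul hρ))).div
      (((contDiffAt_const.mul hρ).mul hΔ).mul (hra.pow 2)) (by positivity)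
  exact hT₁.neg.add hT₂

end Point

/-! ### The covector fields and rank-one forms are `C^n` -/

/-- A covector field `y ↦ ∑ μ c_μ(y) dx^μ` with `C^n` components is `C^n` (a finite sum of `C^n`
scalar multiples of the constant covectors `dx^μ`). [cite: arXiv07060622, (34)] -/
theorem contDiffAt_covector {c : E4 → Fin 4 → ℝ} {x : E4}
    (hc : ∀ μ, ContDiffAt ℝ n (fun y ↦ c y μ) x) :
    ContDiffAt ℝ n (fun y ↦ E4.covector (c y)) x := by
  unfold E4.covector
  exact ContDiffAt.sum fun μ _ ↦ (hc μ).smul contDiffAt_const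

/-- The rank-one form `y ↦ α(y) ⊗ β(y)` of two `C^n` covector fields is `C^n` (`⊗` is Mathlib's
bounded bilinear `smulRight`). [cite: KerrSchild1965, §3] -/
theorem contDiffAt_tmul {α β : E4 → E4 →L[ℝ] ℝ} {x : E4} (hα : ContDiffAt ℝ n α x)
    (hβ : ContDiffAt ℝ n β x) : ContDiffAt ℝ n (fun y ↦ E4.tmul (α y) (β y)) x :=
  hα.smulRight hβ

/-- The rotational covector field `x ↦ σ_x = x dy − y dx` is `C^n` on all of `E4` (its
components are coordinate functions). Hintz–Vasy 2018, proof of (3.15). [cite: HintzVasy2018, §3.2 (3.15)] -/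
theorem contDiffAt_sigma (x : E4) : ContDiffAt ℝ n E4.sigma x := by
  unfold E4.sigma
  refine contDiffAt_covector fun μ ↦ ?_
  fin_cases μ
  · simpa using contDiffAt_const
  · simpa using ((Kerr.contDiff_coord 2 (n := n)).contDiffAt (x := x)).neg
  · simpa using (Kerr.contDiff_coord 1 (n := n)).contDiffAt (x := x)
  · simpa using contDiffAt_const

/-- The radial covector field `x ↦ dr_x` is `C^n` wherever `r > 0` (its components
`r x/ρ², r y/ρ², (r²+a²) z/(r ρ²)` are rational in `(x, r)` with positive denominators). Visser
arXiv:0706.0622, (35). [cite: arXiv07060622, (35)] -/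
theorem contDiffAt_drCovector (a : ℝ) {x : E4} (hx : 0 < Kerr.radius a x) :
    ContDiffAt ℝ n (drCovector a) x := by
  unfold drCovector
  have hr := Kerr.contDiffAt_radius hx (n := n)
  have hρ := contDiffAt_rhoSq a hx (n := n)
  have h1 := (Kerr.contDiff_coord 1 (n := n)).contDiffAt (x := x)
  have h2 := (Kerr.contDiff_coord 2 (n := n)).contDiffAt (x := x)
  have h3 := (Kerr.contDiff_coord 3 (n := n)).contDiffAt (x := x)
  have hρ0 := (rhoSq_pos a hx).ne'
  have hrρ0 : Kerr.radius a x * rhoSq a x ≠ 0 := mul_ne_zero hx.ne' hρ0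
  refine contDiffAt_covector fun μ ↦ ?_
  fin_cases μ
  · simp only [Fin.zero_eta, Fin.isValue, Matrix.cons_val_zero]
    exact contDiffAt_const
  · simp only [Fin.mk_one, Fin.isValue, Matrix.cons_val_one, Matrix.cons_val_zero]
    exact (hr.mul h1).div hρ hρ0
  · simp only [Fin.reduceFinMk, Fin.isValue, Matrix.cons_val]
    exact (hr.mul h2).div hρ hρ0
  · simp only [Fin.reduceFinMk, Fin.isValue, Matrix.cons_val]
    exact (((hr.pow 2).add contDiffAt_const).mul h3).div (hr.mul hρ) hrρ0

/-- The covector field `x ↦ ω_x = dt* − a σ_x/(r² + a²)` is `C^n` wherever `r > 0`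
(Petersen–Vasy (1.8)). [cite: PetersenVasy2021, (1.8)] -/
theorem contDiffAt_omegaCovector (a : ℝ) {x : E4} (hx : 0 < Kerr.radius a x) :
    ContDiffAt ℝ n (omegaCovector a) x := by
  unfold omegaCovector
  have hr := Kerr.contDiffAt_radius hx (n := n)
  have hra : Kerr.radius a x ^ 2 + a ^ 2 ≠ 0 := by positivity
  exact contDiffAt_const.sub
    ((contDiffAt_const.div ((hr.pow 2).add contDiffAt_const) hra).smul (contDiffAt_sigma x))

/-! ### The metric components and the time vector are `C^n` -/

/-- **The angular part `x ↦ angularBilin a Λ x` is `C^n` wherever `r > 0`, for `Λ ≥ 0`**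
(Hintz–Vasy 2018, (3.15) and its proof: the Cartesian rewriting is regular up to the axis).
[cite: HintzVasy2018, §3.2 (3.15)] -/
theorem contDiffAt_angularBilin (a : ℝ) {Λ : ℝ} (hΛ : 0 ≤ Λ) {x : E4} (hx : 0 < Kerr.radius a x) :
    ContDiffAt ℝ n (angularBilin a Λ) x := by
  haveI : IsBoundedSMul ℝ (E4 →L[ℝ] E4 →L[ℝ] ℝ) :=
    @NormedSpace.toIsBoundedSMul ℝ (E4 →L[ℝ] E4 →L[ℝ] ℝ) _ _ _
  unfold angularBilin
  have hr := Kerr.contDiffAt_radius hx (n := n)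
  have hΔ := contDiffAt_deltaTheta a Λ hx (n := n)
  have hρ := contDiffAt_rhoSq a hx (n := n)
  have hs := contDiffAt_sinSq a hx (n := n)
  have hσ := contDiffAt_sigma x (n := n)
  have hdr := contDiffAt_drCovector a hx (n := n)
  have hra : ContDiffAt ℝ n (fun y ↦ Kerr.radius a y ^ 2 + a ^ 2) x := (hr.pow 2).add contDiffAt_const
  have hΔ0 := deltaTheta_pos a hΛ x
  have hρ0 := rhoSq_pos a hx
  have hξ0 := xi_pos hΛ a
  have hra0 : Kerr.radius a x ^ 2 + a ^ 2 ≠ 0 := by positivity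
  have hξρ0 : xi a Λ ^ 2 * rhoSq a x ≠ 0 := by positivity
  have hA : ContDiffAt ℝ n (fun y ↦ (deltaTheta a Λ y)⁻¹ •
      (E4.spatialDelta - (rhoSq a y / (Kerr.radius a y ^ 2 + a ^ 2)) •
        E4.tmul (drCovector a y) (drCovector a y))) x :=
    (hΔ.inv hΔ0.ne').smul (contDiffAt_const.sub ((hρ.div hra hra0).smul (contDiffAt_tmul hdr hdr)))
  have hB : ContDiffAt ℝ n (fun y ↦ sigmaCoeff a Λ y • E4.tmul (E4.sigma y) (E4.sigma y)) x :=
    (contDiffAt_sigmaCoeff a hΛ hx).smul (contDiffAt_tmul hσ hσ)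
  have hC : ContDiffAt ℝ n (fun y ↦ (deltaTheta a Λ y * a ^ 2 * sinSq a y / (xi a Λ ^ 2 * rhoSq a y)) •
      E4.tmul (E4.dx 0) (E4.dx 0)) x :=
    (((hΔ.mul contDiffAt_const).mul hs).div (contDiffAt_const.mul hρ) hξρ0).smul contDiffAt_const
  have hD : ContDiffAt ℝ n (fun y ↦ (deltaTheta a Λ y * a / (xi a Λ ^ 2 * rhoSq a y)) •
      (E4.tmul (E4.dx 0) (E4.sigma y) + E4.tmul (E4.sigma y) (E4.dx 0))) x :=
    ((hΔ.mul contDiffAt_const).div (contDiffAt_const.mul hρ) hξρ0).smul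
      ((contDiffAt_tmul contDiffAt_const hσ).add (contDiffAt_tmul hσ contDiffAt_const))
  exact ((hA.add hB).add hC).sub hD

/-- **The Kerr–de Sitter metric components `x ↦ g_{M,a,Λ}(x)` are `C^n` (every `n ≤ ω`) at every
point with `r > 0` and `R(r) > 0`, for `Λ ≥ 0`** — the Cartesian transcription of Petersen–Vasy
arXiv:2112.01355, (1.8) is rational in `(x, r, √R)` with nonvanishing denominators there.
Hintz–Vasy 2018, Prop. 3.5 (smoothness of `g_b` on `M°`); Petersen–Vasy §1.1 (analyticity).
[cite: HintzVasy2018, Prop. 3.5] -/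
theorem contDiffAt_bilin (M a : ℝ) {Λ : ℝ} (hΛ : 0 ≤ Λ) {x : E4} (hx : 0 < Kerr.radius a x)
    (hR : 0 < tiltNormSq M a Λ (Kerr.radius a x)) : ContDiffAt ℝ n (bilin M a Λ) x := by
  haveI : IsBoundedSMul ℝ (E4 →L[ℝ] E4 →L[ℝ] ℝ) :=
    @NormedSpace.toIsBoundedSMul ℝ (E4 →L[ℝ] E4 →L[ℝ] ℝ) _ _ _
  unfold bilin
  have hr := Kerr.contDiffAt_radius hx (n := n)
  have hρ := contDiffAt_rhoSq a hx (n := n)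
  have hω := contDiffAt_omegaCovector a hx (n := n)
  have hdr := contDiffAt_drCovector a hx (n := n)
  have hρ0 := rhoSq_pos a hx
  have hξ0 := xi_pos hΛ a
  have hξρ0 : xi a Λ ^ 2 * rhoSq a x ≠ 0 := by positivity
  have hδ : ContDiffAt ℝ n (fun y ↦ delta M a Λ (Kerr.radius a y)) x :=
    (contDiff_delta M a Λ).contDiffAt.comp x hr
  have hf : ContDiffAt ℝ n (fun y ↦ tilt M a Λ (Kerr.radius a y)) x :=
    (contDiffAt_tilt M a hΛ hx hR).comp x hr
  have hq : ContDiffAt ℝ n (fun y ↦ radialCoeff M a Λ (Kerr.radius a y)) x :=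
    (contDiffAt_radialCoeff M a hΛ hx hR).comp x hr
  have hA : ContDiffAt ℝ n (fun y ↦ (-(delta M a Λ (Kerr.radius a y) / (xi a Λ ^ 2 * rhoSq a y))) •
      E4.tmul (omegaCovector a y) (omegaCovector a y)) x :=
    (hδ.div (contDiffAt_const.mul hρ) hξρ0).neg.smul (contDiffAt_tmul hω hω)
  have hB : ContDiffAt ℝ n (fun y ↦ (tilt M a Λ (Kerr.radius a y) / xi a Λ) •
      (E4.tmul (omegaCovector a y) (drCovector a y) + E4.tmul (drCovector a y) (omegaCovector a y))) x :=
    (hf.div contDiffAt_const hξ0.ne').smul ((contDiffAt_tmul hω hdr).add (contDiffAt_tmul hdr hω))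
  have hC : ContDiffAt ℝ n (fun y ↦ (rhoSq a y * radialCoeff M a Λ (Kerr.radius a y)) •
      E4.tmul (drCovector a y) (drCovector a y)) x :=
    (hρ.mul hq).smul (contDiffAt_tmul hdr hdr)
  exact ((hA.sub hB).add hC).add (contDiffAt_angularBilin a hΛ hx)

/-- On the chart domain `Kerr.region a r₀` the Kerr–de Sitter metric components are differentiable,
for regular parameters (the hypothesis of the coordinate formulas of `ChartCalculus.lean`).
[cite: HintzVasy2018, Prop. 3.5] -/
theorem differentiableAt_bilin {M a Λ r₀ : ℝ} (h : IsRegular M a Λ r₀) (x : Kerr.region a r₀) :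
    DifferentiableAt ℝ (bilin M a Λ) x :=
  (contDiffAt_bilin M a h.lambda_nonneg (Kerr.radius_pos_of_mem_region x.2)
    (h.tiltNormSq_pos x.2) (n := 1)).differentiableAt one_ne_zero

/-- **The time vector `x ↦ T(x) = −g♯(dt*)` is `C^n` (every `n ≤ ω`) at every point with `r > 0` and
`R(r) > 0`, for `Λ ≥ 0`**: its four Cartesian components are rational in `(x, r, √R)` with
nonvanishing denominators (`ρ²`, `Δ_θ`, `Ξ`, `r² + a²`, `r`, `√R`). Hintz–Vasy 2018, (3.14) and
Prop. 3.5 (smooth dependence of `G_b`). [cite: HintzVasy2018, §3.2 (3.14)] -/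
theorem contDiffAt_timeVector (M a : ℝ) {Λ : ℝ} (hΛ : 0 ≤ Λ) {x : E4} (hx : 0 < Kerr.radius a x)
    (hR : 0 < tiltNormSq M a Λ (Kerr.radius a x)) : ContDiffAt ℝ n (timeVector M a Λ) x := by
  have hr := Kerr.contDiffAt_radius hx (n := n)
  have hρ := contDiffAt_rhoSq a hx (n := n)
  have hΔ := contDiffAt_deltaTheta a Λ hx (n := n)
  have hs := contDiffAt_sinSq a hx (n := n)
  have h1 := (Kerr.contDiff_coord 1 (n := n)).contDiffAt (x := x)
  have h2 := (Kerr.contDiff_coord 2 (n := n)).contDiffAt (x := x)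
  have h3 := (Kerr.contDiff_coord 3 (n := n)).contDiffAt (x := x)
  have hra : ContDiffAt ℝ n (fun y ↦ Kerr.radius a y ^ 2 + a ^ 2) x := (hr.pow 2).add contDiffAt_const
  have hf : ContDiffAt ℝ n (fun y ↦ tilt M a Λ (Kerr.radius a y)) x :=
    (contDiffAt_tilt M a hΛ hx hR).comp x hr
  have hq : ContDiffAt ℝ n (fun y ↦ radialCoeff M a Λ (Kerr.radius a y)) x :=
    (contDiffAt_radialCoeff M a hΛ hx hR).comp x hr
  have hρ0 := (rhoSq_pos a hx).ne'
  have hΔ0 := (deltaTheta_pos a hΛ x).ne'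
  have hra0 : Kerr.radius a x ^ 2 + a ^ 2 ≠ 0 := by positivity
  -- the three coefficient functions `c₀, c₁, c₂` of `timeVector`
  have hc₀ : ContDiffAt ℝ n (fun y ↦ (xi a Λ ^ 2 * radialCoeff M a Λ (Kerr.radius a y) *
      (Kerr.radius a y ^ 2 + a ^ 2) ^ 2 -
        xi a Λ ^ 2 * a ^ 2 * sinSq a y / deltaTheta a Λ y) / rhoSq a y) x :=
    ((((contDiffAt_const.mul hq).mul (hra.pow 2))).sub
      ((contDiffAt_const.mul hs).div hΔ hΔ0)).div hρ hρ0
  have hc₁ : ContDiffAt ℝ n (fun y ↦ (xi a Λ ^ 2 * radialCoeff M a Λ (Kerr.radius a y) *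
      (Kerr.radius a y ^ 2 + a ^ 2) * a - xi a Λ ^ 2 * a / deltaTheta a Λ y) / rhoSq a y) x :=
    (((((contDiffAt_const.mul hq).mul hra)).mul contDiffAt_const).sub
      (contDiffAt_const.div hΔ hΔ0)).div hρ hρ0
  have hc₂ : ContDiffAt ℝ n (fun y ↦ xi a Λ * tilt M a Λ (Kerr.radius a y) *
      (Kerr.radius a y ^ 2 + a ^ 2) / rhoSq a y) x :=
    ((contDiffAt_const.mul hf).mul hra).div hρ hρ0
  have hcomp₁ : ContDiffAt ℝ n (fun y ↦
      -((xi a Λ ^ 2 * radialCoeff M a Λ (Kerr.radius a y) * (Kerr.radius a y ^ 2 + a ^ 2) * a -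
          xi a Λ ^ 2 * a / deltaTheta a Λ y) / rhoSq a y * y 2) +
        xi a Λ * tilt M a Λ (Kerr.radius a y) * (Kerr.radius a y ^ 2 + a ^ 2) / rhoSq a y *
          (Kerr.radius a y * y 1 / (Kerr.radius a y ^ 2 + a ^ 2))) x :=
    (hc₁.mul h2).neg.add (hc₂.mul ((hr.mul h1).div hra hra0))
  have hcomp₂ : ContDiffAt ℝ n (fun y ↦
      (xi a Λ ^ 2 * radialCoeff M a Λ (Kerr.radius a y) * (Kerr.radius a y ^ 2 + a ^ 2) * a -
          xi a Λ ^ 2 * a / deltaTheta a Λ y) / rhoSq a y * y 1 +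
        xi a Λ * tilt M a Λ (Kerr.radius a y) * (Kerr.radius a y ^ 2 + a ^ 2) / rhoSq a y *
          (Kerr.radius a y * y 2 / (Kerr.radius a y ^ 2 + a ^ 2))) x :=
    (hc₁.mul h1).add (hc₂.mul ((hr.mul h2).div hra hra0))
  have hcomp₃ : ContDiffAt ℝ n (fun y ↦
      xi a Λ * tilt M a Λ (Kerr.radius a y) * (Kerr.radius a y ^ 2 + a ^ 2) / rhoSq a y *
        (y 3 / Kerr.radius a y)) x :=
    hc₂.mul (h3.div hr hx.ne')
  rw [contDiffAt_euclidean]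
  intro i
  fin_cases i
  · refine hc₀.congr_of_eventuallyEq (Eventually.of_forall fun y ↦ ?_)
    simp [timeVector]
  · refine hcomp₁.congr_of_eventuallyEq (Eventually.of_forall fun y ↦ ?_)
    simp [timeVector]
  · refine hcomp₂.congr_of_eventuallyEq (Eventually.of_forall fun y ↦ ?_)
    simp [timeVector]
  · refine hcomp₃.congr_of_eventuallyEq (Eventually.of_forall fun y ↦ ?_)
    simp [timeVector]

/-! ### Discharge of the named facts `KerrDeSitter.contMDiff_bilin` and `KerrDeSitter.contMDiff_timeVector` -/

/-- **Discharge of the named fact `KerrDeSitter.contMDiff_bilin`** (field of `KerrDeSitter.Facts`):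
for regular parameters the section `x ↦ g_{M,a,Λ}(x)` of the bundle of bilinear forms on
`T(Kerr.region a r₀)` is real-analytic.  By `OpensChart.contMDiffAt_bilinSection_iff` this is the
analyticity of `KerrDeSitter.bilin M a Λ` at points with `r > max r₀ 0` (`contDiffAt_bilin`; there
`Λ ≥ 0` and `R(r) > 0` by `IsRegular`).  Hintz–Vasy 2018, Prop. 3.5 (smoothness of `g_b` on `M°`,
including the axis); Petersen–Vasy arXiv:2112.01355, §1.1 (real-analyticity of the family in star
coordinates). [cite: HintzVasy2018, Prop. 3.5] -/
theorem contMDiff_bilin_holds : ∀ M a Λ r₀ : ℝ, contMDiff_bilin M a Λ r₀ := by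
  intro M a Λ r₀ h x
  rw [OpensChart.contMDiffAt_bilinSection_iff x _ (bilin M a Λ) (fun _ ↦ rfl)]
  exact contDiffAt_bilin M a h.lambda_nonneg (Kerr.radius_pos_of_mem_region x.2)
    (h.tiltNormSq_pos x.2)

/-- **Discharge of the named fact `KerrDeSitter.contMDiff_timeVector`** (field of
`KerrDeSitter.Facts`): for regular parameters the vector field `x ↦ T(x) = −g♯(dt*)` is a
real-analytic section of `T(Kerr.region a r₀)`.  By `OpensChart.contMDiffAt_section_iff` and
`OpensChart.contMDiffAt_iff` this is the analyticity of `KerrDeSitter.timeVector M a Λ` at points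
with `r > max r₀ 0` (`contDiffAt_timeVector`).  Hintz–Vasy 2018, Prop. 3.5 (smooth dependence of the
dual metric `G_b`, hence of `G_b(dt*, ·)`). [cite: HintzVasy2018, Prop. 3.5] -/
theorem contMDiff_timeVector_holds : ∀ M a Λ r₀ : ℝ, contMDiff_timeVector M a Λ r₀ := by
  intro M a Λ r₀ h x
  rw [ModelWithCorners.tangent]
  rw [OpensChart.contMDiffAt_section_iff x
      (fun y : Kerr.region a r₀ ↦ (timeVector M a Λ y.1 : TangentSpace 𝓘(ℝ, E4) y)),
    OpensChart.contMDiffAt_iff x _ (timeVector M a Λ) (fun _ ↦ rfl)]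
  exact contDiffAt_timeVector M a h.lambda_nonneg (Kerr.radius_pos_of_mem_region x.2)
    (h.tiltNormSq_pos x.2)

end Literature.Geometry.Lorentzian.KerrDeSitter

end
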